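import Summits.QuantumFields.YangMills.Theorems.UnitScaleTiltProp7OmegaOneAxialHolderKnit
import Summits.QuantumFields.YangMills.Theorems.UnitScaleTiltProp7LODDivergenceSupKnit
import Summits.QuantumFields.YangMills.Theorems.UnitScaleTiltProp7OmegaOneKnitAdapters
import Summits.QuantumFields.YangMills.Theorems.UnitScaleTiltProp7GaugeProjectorRSSupMember
import HarnessLib

/-!
# Route `UnitScaleTilt`, crux K1 «MinimiserStabilityRegPr» (stmt-QuantumFields-19200), EX row (6) `norm_H₁` ∕ STOREY H letter `h3` — **(M) THE WINDOWED COVER-AXIAL ½-HÖLDER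
# LETTER OF `ω₁ A` AT ONE MEMBER, EVERY PIN LETTER OF THE KNIT DISCHARGED** (chair ★p1 g29 WORD №68 (b); ★★OWNER g38 №149∕№155: pen of record (M) → (F)).

WHAT IS PROVED (ns `Summit.QuantumFields.YangMills.Theorems.Prop7OmegaOneAxialHolderMember`):
* §0 `window_delta_exp` — the (β-L²) window `3(e·μ)² + a·(25∕8)·(e^{3μ}−1)² ≤ (√(27 + 2025∕8·a)·μ)²` for `3μ ≤ 1` (twin of ✓`window_delta` for px21's `e`-shaped letter); `unitPen_pin` — the
  unit leaf of ✓`hPen_of_regPr`'s constant at the pinned weight `c₁ = c₀(L³)^{K−n}`.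
* §1 ★★ `hax_omega_one_member` — ✓p782059 `Prop7OmegaOneAxialHolderKnit.hax_omega_one` at ONE member with the LOD data at the pinned weight and mass `0 < am`, EVERY pin letter
  discharged BY NAME: `hUsup` ⟸ px5 g16 ✓`Prop7LODDivergenceSupKnit.sup_G_DstarL2_le` (DOOR-Q ∘ px21 g17 (β-L²) ✓`sq_sum_ball_G_DstarL2_le_kfree` ∘ ✓`hPen_of_regPr`) at the window
  `μ(am) := 1∕(10√(max 2 (16∕am))·√(27 + 2025∕8·am))`, `δ₁(am) := √(27 + 2025∕8·am)·μ(am)` (§0 + ✓`window_win`); `hPen` ⟸ px13 g17 ✓`Prop7PenaltySupLetter.hPen_of_regPr`;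
  `hcompl`∕`hsrc` (with `Cc := ` the n-level site space, `cs := c`, `Tc := T`) ⟸ px5 ✓`Prop7GaugeProjectorSupPackagePin.hsrc_pin_exists` at V5b's `hcol` ⟸ ✓`hcol_of_massiveColumn_decay`
  (window ✓`window_delta`∕✓`window_win`); `hGw`∕`hDw` ⟸ px13 g17 ✓`Prop7OmegaOneKnitAdapters.hGw_of_lift`∕`hDw_of_lift` (V5b ✓`hGsup_of_regPr`, W-T1 ✓`hT1_of_regPr_allMembers`);
  `hε1` from `10⁷L³ε₀ ≤ 1`; signs by `positivity`; the constant made MEMBER-FREE by the unit leaves ✓`unitU3_pin`∕`unitU1_pin`∕`unitA_pin`∕`unitP1_pin`∕`unitP2_pin`∕`unitP3_pin`∕§0.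
  DISPLAYED (nothing else): `RegPr F n K ε₀ U₀` (`0 < ε₀`, `10⁷L³ε₀ ≤ 1`), the LOD data `Q″ hseq ι hι T hT G hAG hGA` at the pin with `hRS`∕`hker` (discharged in §2 from the Lift
  antecedent), the slot class `hp hΔs hΔ` (generic `aT, Δx`), the two ∃-closed local letters `hHlocV` (✓`exists_hHlocV`, 857ccd79 text) and `hWsup` (✓`exists_hWsup`, a03f6c18 text) with
  their caps `48ε₀ ≤ θ₀`, `ε₀ ≤ θw`, and the local-gradient cap `hsmall`.
* §2 ★★★ `hax_omega_one_member_of_lift` — §1 with `Q″ hseq hker ← exists_intertwiner_of_regPr`, `hRS ← RS_eq_projR_of_lift (hLift)`, `ι` by `rfl`, `T := (ι∘Q″)†`,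
  `G ← exists_massive_inverse` (px5's wrapper recipe, as in ✓`Prop7GaugeProjectorRSSupMember.norm_equiv_RS_le_member_of_lift`); displayed: `RegPr` with `10¹²L³ε₀ ≤ 1`, Lift, slot class,
  the two local letters + caps, `hsmall`; mass `am` free (the family takes `am := 1`).

HONEST BLOCK.  Assembly only: every analytic input is a tree theorem named above; no `sorry`, default axioms; decl-local `maxHeartbeats 400000` on §1∕§2 (the closed constant is
several kchars and is matched syntactically after the unit leaves — README heartbeat rule, disclosed).  Nothing of EX∕19200 is claimed beyond this letter; (F) the all-members
family `hHωw_family_exists` is the NEXT file.  Rung R3 = SU(2) YM₃ on T³ — NOT d = 4, NOT infinite volume, NOT a mass gap, NOT Clay.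
[cite: Balaban1985BackgroundPropagators, Thm 3.1 (3.42)–(3.46) pp.397–398, (3.20)–(3.25) p.394, (3.49) p.399, (3.151)–(3.152) pp.425–426; Balaban1984PropagatorsII, (1.9) p.226,
Lemma 2.1 (2.61)–(2.63) p.234; Balaban1985Variational, (138)–(139) p.299]
-/

set_option autoImplicit false

noncomputable section

open scoped BigOperators Matrix.Norms.L2Operator InnerProductSpace ComplexConjugate Matrix

namespace Summit.QuantumFields.YangMills.Theorems.Prop7OmegaOneAxialHolderMember

open Literature.MathematicalPhysics.QuantumFieldTheory.Balaban1983to89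
open Literature.MathematicalPhysics.QuantumFieldTheory.Balaban1983to89.T3ContinuumYM3Torus
open T4Continuum BlockAveraging
open BlockAveraging (Idx off)
open B7Prop1Explicit (disp)
open B5Eq118OneStroke (iterBlockOf)
open B15DeterminingSets (embIter)
open B10Eq27TorusAxialLog (axialT holT transl)
open B7TransferAnalyticMean (meanCLM)
open B4Sect5Torus (TSite tdist)
open B9SectCLatticeCarrier (Bond)
open B9Eq311L2Pairing (WL2)
open B11Eq103H1Complex (SiteL2K BondL2K projR)
open Summit.QuantumFields.YangMills.Theorems.Prop8Chart (emlIterU)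
open T3SectALandauChart (eta eta_pos bgUnits)
open T3PrintedRegularMinimiser (RegPr)
open T3PrintedRegularOrbits (sites_eq)
open T3LevelShift (siteShift)
open Summit.QuantumFields.YangMills.Theorems.Prop7SectET3Transport (periodsT3 siteEquiv bondEquiv bgOfCfg)
open Summit.QuantumFields.YangMills.Theorems.Prop7SectET3HilbertLetters (W₂ toL2 toL2S DL2 DstarL2 covLapSite)
open Summit.QuantumFields.YangMills.Theorems.Prop7SectET3GaugeProjector (NS RS)
open Summit.QuantumFields.YangMills.Theorems.Prop7SectET3CurvedPropagators (PosOnto GT)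
open Summit.QuantumFields.YangMills.Theorems.Prop7LODSlotK2WindowLetters (window_delta window_win exp_three_mul_sub_one_le_nine_mul)
open Summit.QuantumFields.YangMills.Theorems.Prop7ComplementaryProjectorPointwiseDecayClosed (hcol_of_massiveColumn_decay)
open Summit.QuantumFields.YangMills.Theorems.Prop7CurvedMemberGradientRowPin (unitA_pin unitU1_pin unitU3_pin)
open Summit.QuantumFields.YangMills.Theorems.Prop7CurvedMemberLocalGradient (exists_curved_localGradient)
open Summit.QuantumFields.YangMills.Theorems.AxialGaugeChartGlue (norm_bgOfCfg_axialT_sub_le)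
open Summit.QuantumFields.YangMills.Theorems.Prop7NSIntertwinerOfRecord (exists_intertwiner_of_regPr)
open Summit.QuantumFields.YangMills.Theorems.Prop7RSEqPrintProjectorOfLift (RS_eq_projR_of_lift)
open Summit.QuantumFields.YangMills.Theorems.Prop7MassivePropagatorCoercive (exists_massive_inverse)
open Summit.QuantumFields.YangMills.Theorems.Prop7PcolMember (unitP1_pin unitP3_pin unitP2_pin)
open Summit.QuantumFields.YangMills.Theorems.Prop7GaugeProjectorSupPackagePin (hsrc_pin_exists)
open Summit.QuantumFields.YangMills.Theorems.Prop7PenaltySupLetter (hPen_of_regPr)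
open Summit.QuantumFields.YangMills.Theorems.Prop7LODDivergenceSupKnit (sup_G_DstarL2_le)
open Summit.QuantumFields.YangMills.Theorems.Prop7OmegaOneKnitAdapters (hGw_of_lift hDw_of_lift)
open Summit.QuantumFields.YangMills.Theorems.Prop7OmegaOneAxialHolderKnit (hax_omega_one)
open Summit.QuantumFields.YangMills.Theorems.CoverSites

/-! ## §0 Two scalar leaves -/

/-- (β-L²) window at slope `μ`, `3μ ≤ 1`: `3(e·μ)² + a·sx·(e^{3μ}−1)² ≤ (√(27 + 2025∕8·a)·μ)²` (`e² ≤ 9`, `e^{3μ} − 1 ≤ 9μ`). [cite: Balaban1985BackgroundPropagators, (3.46) p.398, (3.49) p.399] -/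
theorem window_delta_exp {a sx : ℝ} (ha : 0 < a) (hsx : sx = 25 / 8) {μ : ℝ} (hμ0 : 0 ≤ μ) (hμ1 : 3 * μ ≤ 1) :
    3 * (Real.exp 1 * μ) ^ 2 + a * sx * (Real.exp (3 * μ) - 1) ^ 2 ≤ (Real.sqrt (27 + 2025 / 8 * a) * μ) ^ 2 := by
  subst hsx
  have t2 := exp_three_mul_sub_one_le_nine_mul hμ0 hμ1
  have t2' : 0 ≤ Real.exp (3 * μ) - 1 := by have := Real.add_one_le_exp (3 * μ); linarith
  have e2 : (Real.sqrt (27 + 2025 / 8 * a) * μ) ^ 2 = (27 + 2025 / 8 * a) * μ ^ 2 := by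
    rw [mul_pow, Real.sq_sqrt (by positivity)]
  rw [e2]
  have he : Real.exp 1 ≤ 3 := by have := Real.exp_one_lt_d9; linarith
  have he0 : 0 ≤ Real.exp 1 := (Real.exp_pos 1).le
  have h1 : (Real.exp 1 * μ) ^ 2 ≤ (3 * μ) ^ 2 := pow_le_pow_left₀ (by positivity) (mul_le_mul_of_nonneg_right he hμ0) 2
  have h2 : (Real.exp (3 * μ) - 1) ^ 2 ≤ (9 * μ) ^ 2 := pow_le_pow_left₀ t2' t2 2
  nlinarith [h1, h2, ha.le]

/-- The unit leaf of ✓`hPen_of_regPr`'s constant at the pinned weight `c₁ = c₀(L³)^{K−n}`: `a·((5∕4)√(2c₁)·(L^{3(K−n)})⁻¹∕c₀)·√((25∕8)(c₁(L^{3(K−n)})⁻¹∕c₀))·√(c₀L^{3(K−n)}) = a·((5∕4)√2)·√(25∕8)`.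
[cite: Balaban1985BackgroundPropagators, (3.24) p.394] -/
theorem unitPen_pin (F : T3Family) {n K : ℕ} {c₀ : ℝ} (hc₀ : 0 < c₀) (am : ℝ) :
    am * ((5 / 4) * Real.sqrt (2 * (c₀ * ((F.L : ℝ) ^ 3) ^ (K - n))) * ((((F.P K).L : ℝ) ^ (F.P K).d) ^ (K - n))⁻¹ / c₀) *
        Real.sqrt ((25 / 8) * ((c₀ * ((F.L : ℝ) ^ 3) ^ (K - n)) * ((((F.P K).L : ℝ) ^ (F.P K).d) ^ (K - n))⁻¹ / c₀)) *
        Real.sqrt (c₀ * ((((F.P K).L : ℝ) ^ (F.P K).d) ^ (K - n))) = am * ((5 / 4) * Real.sqrt 2) * Real.sqrt (25 / 8) := by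
  have hL : (0 : ℝ) < F.L := by have := F.hL.2; exact_mod_cast (by omega : 0 < F.L)
  have hPL : ((F.P K).L : ℝ) = (F.L : ℝ) := by norm_cast
  have hX : ((((F.P K).L : ℝ) ^ (F.P K).d) ^ (K - n)) = ((F.L : ℝ) ^ 3) ^ (K - n) := by rw [hPL, T3Family.P_d]
  have h3 : (0 : ℝ) < ((F.L : ℝ) ^ 3) ^ (K - n) := by positivity
  have hS : (25 / 8 : ℝ) * ((c₀ * ((F.L : ℝ) ^ 3) ^ (K - n)) * ((((F.P K).L : ℝ) ^ (F.P K).d) ^ (K - n))⁻¹ / c₀) = 25 / 8 := by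
    rw [hX]; field_simp
  rw [hS, hX]
  have h2 : Real.sqrt (2 * (c₀ * ((F.L : ℝ) ^ 3) ^ (K - n))) = Real.sqrt 2 * Real.sqrt (c₀ * ((F.L : ℝ) ^ 3) ^ (K - n)) :=
    Real.sqrt_mul (by norm_num) _
  rw [h2]
  have hcc : Real.sqrt (c₀ * ((F.L : ℝ) ^ 3) ^ (K - n)) * Real.sqrt (c₀ * ((F.L : ℝ) ^ 3) ^ (K - n)) = c₀ * ((F.L : ℝ) ^ 3) ^ (K - n) :=
    Real.mul_self_sqrt (by positivity)
  have hcc' : Real.sqrt (c₀ * ((F.L : ℝ) ^ 3) ^ (K - n)) * Real.sqrt (c₀ * ((F.L : ℝ) ^ 3) ^ (K - n)) * (((F.L : ℝ) ^ 3) ^ (K - n))⁻¹ / c₀ = 1 := by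
    rw [hcc]; field_simp
  calc am * ((5 / 4) * (Real.sqrt 2 * Real.sqrt (c₀ * ((F.L : ℝ) ^ 3) ^ (K - n))) * (((F.L : ℝ) ^ 3) ^ (K - n))⁻¹ / c₀) * Real.sqrt (25 / 8) *
        Real.sqrt (c₀ * ((F.L : ℝ) ^ 3) ^ (K - n))
        = am * ((5 / 4) * Real.sqrt 2) * Real.sqrt (25 / 8) *
          (Real.sqrt (c₀ * ((F.L : ℝ) ^ 3) ^ (K - n)) * Real.sqrt (c₀ * ((F.L : ℝ) ^ 3) ^ (K - n)) * (((F.L : ℝ) ^ 3) ^ (K - n))⁻¹ / c₀) := by ring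
    _ = am * ((5 / 4) * Real.sqrt 2) * Real.sqrt (25 / 8) := by rw [hcc', mul_one]

variable (F : T3Family) {n K : ℕ} (h : n ≤ K) {c₀ cB : ℝ} [Fact (0 < c₀)] [Fact (0 < cB)]
  {ε₀ : ℝ} (hε₀ : 0 < ε₀) (hε7 : 10 ^ 7 * (F.L : ℝ) ^ 3 * ε₀ ≤ 1)
  (U₀ : GaugeField (F.P K) 0 (Matrix.specialUnitaryGroup (Fin 2) ℂ)) (hreg : RegPr F n K ε₀ U₀)
  (Q'' : SiteL2K ℂ 3 (periodsT3 F K) c₀ W₂ →ₗ[ℂ] (Site (F.P K) (K - n) → Matrix (Fin 2) (Fin 2) ℂ))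
  (hseq : ∀ lam : Site (F.P K) 0 → Matrix (Fin 2) (Fin 2) ℂ, ∃ ns : (j : ℕ) → Site (F.P K) j → Matrix (Fin 2) (Fin 2) ℂ, ns 0 = lam ∧
      (∀ (j : ℕ) (y : Site (F.P K) (j + 1)), ns (j + 1) y = ns j (emb y) - meanCLM (Idx (F.P K)) (Matrix (Fin 2) (Fin 2) ℂ) fun i : Idx (F.P K) =>
        ns j (emb y) - ((holT (emlIterU j (bgUnits F K U₀)) (emb y) (stairWord i.2.1 (off i.1)) : (Matrix (Fin 2) (Fin 2) ℂ)ˣ) : Matrix (Fin 2) (Fin 2) ℂ) *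
          ns j (transl (emb y) (disp (stairWord i.2.1 (off i.1)))) * (((holT (emlIterU j (bgUnits F K U₀)) (emb y) (stairWord i.2.1 (off i.1)))⁻¹ : (Matrix (Fin 2) (Fin 2) ℂ)ˣ) : Matrix (Fin 2) (Fin 2) ℂ)) ∧
      ns (K - n) = Q'' (toL2S F K c₀ lam))
  (hRS : RS F n K h c₀ cB U₀ = projR (covLapSite F n K c₀ U₀) Q'')
  (hker : LinearMap.ker Q'' ≤ NS F n K h c₀ cB U₀)

/-! ## §1 The knit at one member, every pin letter discharged -/

include hε₀ hε7 hreg hseq hRS hker in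
-- HEARTBEAT rule (README): the ~7-kchar closed constant is matched by `rw … at key; exact key` (syntactic after the unit leaves); decl-local 400000, disclosed.
set_option maxHeartbeats 400000 in
/-- ★★ **(M) THE WINDOWED COVER-AXIAL ½-HÖLDER LETTER OF `ω₁ A = R_S(D*_{U₀}(G_{Δx}(toL2 A)))` AT ONE MEMBER, EVERY PIN LETTER OF THE KNIT DISCHARGED, MEMBER-FREE CONSTANT**
(✓`hax_omega_one` at: `hUsup` ⟸ ✓`sup_G_DstarL2_le` (§0 window), `hPen` ⟸ ✓`hPen_of_regPr`, `hcompl`∕`hsrc` ⟸ ✓`hsrc_pin_exists` at ✓`hcol_of_massiveColumn_decay`, `hGw`∕`hDw` ⟸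
✓`hGw_of_lift`∕`hDw_of_lift`, signs by `positivity`, unit leaves).  Displayed: `RegPr F n K ε₀ U₀` (`0 < ε₀`, `10⁷L³ε₀ ≤ 1`), the LOD data at the pinned weight with mass `0 < am`
(`Q″ hseq hRS hker ι hι T hT G hAG hGA`), the slot class `hp hΔs hΔ`, the local letters `hHlocV`∕`hWsup` with caps `48ε₀ ≤ θ₀`, `ε₀ ≤ θw`, and `hsmall`.  The constant depends on
`am, ε₀, Ch, Cw` and the two L-free `choose` constants only.
[cite: Balaban1985BackgroundPropagators, Thm 3.1 (3.42)–(3.46) pp.397–398, (3.20)–(3.25) p.394, (3.49) p.399, (3.151)–(3.152) pp.425–426; Balaban1984PropagatorsII, (1.9) p.226, Lemma 2.1 p.234] -/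
theorem hax_omega_one_member (hnK : n < K) {am : ℝ} (ham : 0 < am) [hc₁ : Fact (0 < c₀ * ((F.L : ℝ) ^ 3) ^ (K - n))]
    (ι : (Site (F.P K) (K - n) → Matrix (Fin 2) (Fin 2) ℂ) →ₗ[ℂ] SiteL2K ℂ 3 (periodsT3 F n) (c₀ * ((F.L : ℝ) ^ 3) ^ (K - n)) W₂)
    (hι : ∀ c, ι c = toL2S F n (c₀ * ((F.L : ℝ) ^ 3) ^ (K - n)) (fun z => c (siteShift (sites_eq F n K h) z)))
    (T : SiteL2K ℂ 3 (periodsT3 F n) (c₀ * ((F.L : ℝ) ^ 3) ^ (K - n)) W₂ →ₗ[ℂ] SiteL2K ℂ 3 (periodsT3 F K) c₀ W₂)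
    (hT : ∀ (l : SiteL2K ℂ 3 (periodsT3 F K) c₀ W₂) (f : SiteL2K ℂ 3 (periodsT3 F n) (c₀ * ((F.L : ℝ) ^ 3) ^ (K - n)) W₂), ⟪ι (Q'' l), f⟫_ℂ = ⟪l, T f⟫_ℂ)
    (G : SiteL2K ℂ 3 (periodsT3 F K) c₀ W₂ →ₗ[ℂ] SiteL2K ℂ 3 (periodsT3 F K) c₀ W₂)
    (hAG : ∀ f, covLapSite F n K c₀ U₀ (G f) + (am : ℂ) • T (ι (Q'' (G f))) = f)
    (hGA : ∀ u, G (covLapSite F n K c₀ U₀ u + (am : ℂ) • T (ι (Q'' u))) = u)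
    {aT : ℝ} {Δx : GaugeField (F.P K) 0 (Matrix.specialUnitaryGroup (Fin 2) ℂ) → (BondL2K ℂ 3 (periodsT3 F K) c₀ W₂ →ₗ[ℂ] BondL2K ℂ 3 (periodsT3 F K) c₀ W₂)}
    (hp : PosOnto F n K h c₀ cB aT Δx U₀) (hΔs : (Δx U₀).IsSymmetric) (hΔ : ∀ l ∈ NS F n K h c₀ cB U₀, Δx U₀ (DL2 F n K c₀ U₀ l) = 0)
    {Ch θ₀ : ℝ} (hCh : 0 ≤ Ch) (hθ : 48 * ε₀ ≤ θ₀)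
    (hHlocV : ∀ (F : T3Family) (n K : ℕ) (c₀ : ℝ) [Fact (0 < c₀)] (V : GaugeField (F.P K) 0 (Matrix.specialUnitaryGroup (Fin 2) ℂ))
      (u q : SiteL2K ℂ 3 (periodsT3 F K) c₀ W₂) (f : BondL2K ℂ 3 (periodsT3 F K) c₀ W₂) (x : TSite 3 (periodsT3 F K)) (Mu Mf Mq δ : ℝ),
      0 ≤ Mu → 0 ≤ Mf → 0 ≤ Mq → 0 ≤ δ → (F.L : ℝ) ^ (K - n) * δ ≤ θ₀ →
      covLapSite F n K c₀ V u + q = DstarL2 F n K c₀ V f →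
      (∀ y, tdist (periodsT3 F K) x y ≤ 4 * (F.L : ℝ) ^ (K - n) + 1 → ‖WL2.equiv ℂ (fun _ : TSite 3 (periodsT3 F K) => c₀) W₂ u y‖ ≤ Mu) →
      (∀ (y : TSite 3 (periodsT3 F K)) (μ : Fin 3), tdist (periodsT3 F K) x y ≤ 4 * (F.L : ℝ) ^ (K - n) + 1 →
        ‖WL2.equiv ℂ (fun _ : Bond 3 (periodsT3 F K) => c₀) W₂ f (y, μ)‖ ≤ Mf) →
      (∀ y, tdist (periodsT3 F K) x y ≤ 4 * (F.L : ℝ) ^ (K - n) + 1 → ‖WL2.equiv ℂ (fun _ : TSite 3 (periodsT3 F K) => c₀) W₂ q y‖ ≤ Mq) →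
      (∀ (y : TSite 3 (periodsT3 F K)) (μ : Fin 3), tdist (periodsT3 F K) x y ≤ 4 * (F.L : ℝ) ^ (K - n) + 1 →
        ‖((bgOfCfg F K V (y, μ) : (Matrix (Fin 2) (Fin 2) ℂ)ˣ) : Matrix (Fin 2) (Fin 2) ℂ) - 1‖ ≤ δ) →
      ∀ x' : TSite 3 (periodsT3 F K), tdist (periodsT3 F K) x x' ≤ (F.L : ℝ) ^ (K - n) →
        ‖WL2.equiv ℂ (fun _ : TSite 3 (periodsT3 F K) => c₀) W₂ u x' - WL2.equiv ℂ (fun _ : TSite 3 (periodsT3 F K) => c₀) W₂ u x‖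
          ≤ Ch * (Mu + Mf + Mq) * (tdist (periodsT3 F K) x x' / ((F.L : ℝ) ^ (K - n))) ^ ((1 : ℝ) / 2))
    {Cw θw : ℝ} (hCw : 0 ≤ Cw) (hθw : ε₀ ≤ θw)
    (hWsup : ∀ (F : T3Family) (n K : ℕ) (c₀ : ℝ) [Fact (0 < c₀)] (ε₀ : ℝ) (U₀ : GaugeField (F.P K) 0 (Matrix.specialUnitaryGroup (Fin 2) ℂ)),
      0 ≤ ε₀ → ε₀ ≤ θw → RegPr F n K ε₀ U₀ →
      ∀ (w : SiteL2K ℂ 3 (periodsT3 F K) c₀ W₂) (x : BondL2K ℂ 3 (periodsT3 F K) c₀ W₂) (X : ℝ), 0 ≤ X →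
      covLapSite F n K c₀ U₀ w + ((1 : ℝ) : ℂ) • w = DstarL2 F n K c₀ U₀ x →
      (∀ b : Bond 3 (periodsT3 F K), ‖WL2.equiv ℂ (fun _ : Bond 3 (periodsT3 F K) => c₀) W₂ x b‖ ≤ X) →
      ∀ y : TSite 3 (periodsT3 F K), ‖WL2.equiv ℂ (fun _ : TSite 3 (periodsT3 F K) => c₀) W₂ w y‖ ≤ Cw * X)
    (hsmall : exists_curved_localGradient.choose * ((48 * ε₀) * (6 * Real.sqrt 2 * Real.sqrt 10 + 6 * Real.sqrt 2)) ≤ 1 / 2) :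
    ∀ A : PBond (F.P K) 0 → Matrix (Fin 2) (Fin 2) ℂ,
    ∀ (ct : Site ((F.cover 3).P K) 0) (yt yt' : TSite 3 (periodsT3 (F.cover 3) K)),
      tdist (periodsT3 (F.cover 3) K) (siteEquiv (F.cover 3) K ct) yt ≤ 4 * (F.L : ℝ) ^ (K - n) + 1 →
      tdist (periodsT3 (F.cover 3) K) (siteEquiv (F.cover 3) K ct) yt' ≤ 4 * (F.L : ℝ) ^ (K - n) + 1 →
      tdist (periodsT3 (F.cover 3) K) yt yt' ≤ (F.L : ℝ) ^ (K - n) →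
      ‖WL2.equiv ℂ (fun _ : TSite 3 (periodsT3 (F.cover 3) K) => c₀) W₂
            (toL2S (F.cover 3) K c₀ (fun zt => ((axialT (U₀ ∘ projBond (F.P K) 3 0) ct zt : Matrix.specialUnitaryGroup (Fin 2) ℂ) : Matrix (Fin 2) (Fin 2) ℂ)
              * (toL2S F K c₀).symm (RS F n K h c₀ cB U₀ (DstarL2 F n K c₀ U₀ (GT F n K h c₀ cB aT Δx U₀ (toL2 F K c₀ A)))) (proj (F.P K) 3 0 zt)
              * star ((axialT (U₀ ∘ projBond (F.P K) 3 0) ct zt : Matrix.specialUnitaryGroup (Fin 2) ℂ) : Matrix (Fin 2) (Fin 2) ℂ))) yt'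
          - WL2.equiv ℂ (fun _ : TSite 3 (periodsT3 (F.cover 3) K) => c₀) W₂
            (toL2S (F.cover 3) K c₀ (fun zt => ((axialT (U₀ ∘ projBond (F.P K) 3 0) ct zt : Matrix.specialUnitaryGroup (Fin 2) ℂ) : Matrix (Fin 2) (Fin 2) ℂ)
              * (toL2S F K c₀).symm (RS F n K h c₀ cB U₀ (DstarL2 F n K c₀ U₀ (GT F n K h c₀ cB aT Δx U₀ (toL2 F K c₀ A)))) (proj (F.P K) 3 0 zt)
              * star ((axialT (U₀ ∘ projBond (F.P K) 3 0) ct zt : Matrix.specialUnitaryGroup (Fin 2) ℂ) : Matrix (Fin 2) (Fin 2) ℂ))) yt‖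
        ≤ (Real.sqrt 2 * (Ch * (2 * Cw + 1) + 3 * Real.sqrt 10 * (2 * (exists_curved_localGradient.choose * ((2 * (8 * Ch * (1 + am * (5 / 4 * Real.sqrt 2) * Real.sqrt (25 / 8)) + 1) ^ 3 * Real.sqrt (3 * Real.exp (12 * (1 / (10 * Real.sqrt (max 2 (16 / am)) * Real.sqrt (27 + 2025 / 8 * am)))) * (2 * (1 + 1 / (2 * (1 / (10 * Real.sqrt (max 2 (16 / am)) * Real.sqrt (27 +
          2025 / 8 * am)))))) ^ 3 * (32 * max 2 (16 / am) + 384 * Real.exp 1 ^ 2 * (1 / (10 * Real.sqrt (max 2 (16 / am)) * Real.sqrt (27 + 2025 / 8 * am))) ^ 2 * max 2 (16 / am) ^ 2)) + 1 + Cw) * (2 + 2 * Real.sqrt 2 * (4 * ε₀ * (3 + 2457 * norm_bgOfCfg_axialT_sub_le.choose)) + (24 * Real.sqrt 10 + 48) * (48 * ε₀) ^ 2) + (am * (5 / 4 * Real.sqrt 2) * Real.sqrt (25 /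
          8) * (2 * (8 * Ch * (1 + am * (5 / 4 * Real.sqrt 2) * Real.sqrt (25 / 8)) + 1) ^ 3 * Real.sqrt (3 * Real.exp (12 * (1 / (10 * Real.sqrt (max 2 (16 / am)) * Real.sqrt (27 + 2025 / 8 * am)))) * (2 * (1 + 1 / (2 * (1 / (10 * Real.sqrt (max 2 (16 / am)) * Real.sqrt (27 + 2025 / 8 * am)))))) ^ 3 * (32 * max 2 (16 / am) + 384 * Real.exp 1 ^ 2 * (1 / (10 *
          Real.sqrt (max 2 (16 / am)) * Real.sqrt (27 + 2025 / 8 * am))) ^ 2 * max 2 (16 / am) ^ 2)) + 1) + Cw)) + 2 * Real.sqrt 2 * (48 * ε₀) * (2 * (8 * Ch * (1 + am * (5 / 4 * Real.sqrt 2) * Real.sqrt (25 / 8)) + 1) ^ 3 * Real.sqrt (3 * Real.exp (12 * (1 / (10 * Real.sqrt (max 2 (16 / am)) * Real.sqrt (27 + 2025 / 8 * am)))) * (2 * (1 + 1 / (2 * (1 / (10 *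
          Real.sqrt (max 2 (16 / am)) * Real.sqrt (27 + 2025 / 8 * am)))))) ^ 3 * (32 * max 2 (16 / am) + 384 * Real.exp 1 ^ 2 * (1 / (10 * Real.sqrt (max 2 (16 / am)) * Real.sqrt (27 + 2025 / 8 * am))) ^ 2 * max 2 (16 / am) ^ 2)) + 1 + Cw)) + 2 * Real.sqrt 2 * (48 * ε₀) * (2 * (8 * Ch * (1 + am * (5 / 4 * Real.sqrt 2) * Real.sqrt (25 / 8)) + 1) ^ 3 * Real.sqrt (3 *
          Real.exp (12 * (1 / (10 * Real.sqrt (max 2 (16 / am)) * Real.sqrt (27 + 2025 / 8 * am)))) * (2 * (1 + 1 / (2 * (1 / (10 * Real.sqrt (max 2 (16 / am)) * Real.sqrt (27 + 2025 / 8 * am)))))) ^ 3 * (32 * max 2 (16 / am) + 384 * Real.exp 1 ^ 2 * (1 / (10 * Real.sqrt (max 2 (16 / am)) * Real.sqrt (27 + 2025 / 8 * am))) ^ 2 * max 2 (16 / am) ^ 2)) + 1 + Cw)) + 3 *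
          Real.sqrt 10 * (2 * (exists_curved_localGradient.choose * ((14 * (8 * Real.exp (3 * min (1 / (10 * Real.sqrt (max 2 (16 / am)) * Real.sqrt (27 + 2025 / 8 * am))) (1 / 4)) * (1 + Real.exp (3 * (1 / (10 * Real.sqrt (max 2 (16 / am)) * Real.sqrt (27 + 2025 / 8 * am)))) * (am * (5 / 4 * Real.sqrt 2) * Real.sqrt (25 / 8) * (8 * Real.sqrt (max 2 (16 / am)) ^ 2))))
          + Real.sqrt 216 * (Real.sqrt (8 * Real.exp (3 * min (1 / (10 * Real.sqrt (max 2 (16 / am)) * Real.sqrt (27 + 2025 / 8 * am))) (1 / 4)) * Real.exp (6 * (1 / (10 * Real.sqrt (max 2 (16 / am)) * Real.sqrt (27 + 2025 / 8 * am)))) * (2 * (1 + 1 / (1 / (10 * Real.sqrt (max 2 (16 / am)) * Real.sqrt (27 + 2025 / 8 * am))))) ^ 3) * (8 * Real.sqrt (max 2 (16 / am)) ^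
          2))) * (2 * (1 + 1 / (min (1 / (10 * Real.sqrt (max 2 (16 / am)) * Real.sqrt (27 + 2025 / 8 * am))) (1 / 4) / 2))) ^ 3 * (2 + 2 * Real.sqrt 2 * (4 * ε₀ * (3 + 2457 * norm_bgOfCfg_axialT_sub_le.choose)) + (24 * Real.sqrt 10 + 48) * (48 * ε₀) ^ 2) + (am * (5 / 4 * Real.sqrt 2) * Real.sqrt (25 / 8) * (Real.exp (3 * (1 / (10 * Real.sqrt (max 2 (16 / am)) *
          Real.sqrt (27 + 2025 / 8 * am)))) * (8 * Real.sqrt (max 2 (16 / am)) ^ 2)) * (2 * (1 + 1 / (1 / (10 * Real.sqrt (max 2 (16 / am)) * Real.sqrt (27 + 2025 / 8 * am))))) ^ 3 + 1)) + 2 * Real.sqrt 2 * (48 * ε₀) * ((14 * (8 * Real.exp (3 * min (1 / (10 * Real.sqrt (max 2 (16 / am)) * Real.sqrt (27 + 2025 / 8 * am))) (1 / 4)) * (1 + Real.exp (3 * (1 / (10 *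
          Real.sqrt (max 2 (16 / am)) * Real.sqrt (27 + 2025 / 8 * am)))) * (am * (5 / 4 * Real.sqrt 2) * Real.sqrt (25 / 8) * (8 * Real.sqrt (max 2 (16 / am)) ^ 2)))) + Real.sqrt 216 * (Real.sqrt (8 * Real.exp (3 * min (1 / (10 * Real.sqrt (max 2 (16 / am)) * Real.sqrt (27 + 2025 / 8 * am))) (1 / 4)) * Real.exp (6 * (1 / (10 * Real.sqrt (max 2 (16 / am)) * Real.sqrt
          (27 + 2025 / 8 * am)))) * (2 * (1 + 1 / (1 / (10 * Real.sqrt (max 2 (16 / am)) * Real.sqrt (27 + 2025 / 8 * am))))) ^ 3) * (8 * Real.sqrt (max 2 (16 / am)) ^ 2))) * (2 * (1 + 1 / (min (1 / (10 * Real.sqrt (max 2 (16 / am)) * Real.sqrt (27 + 2025 / 8 * am))) (1 / 4) / 2))) ^ 3)) * (10 * (18 / (2 / ((1 + 25 / 8) * (600 * (27 / 4) ^ 6 + am))) ^ 2) * (4 * (2 *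
          (1 + 1 / min (1 / (10 * Real.sqrt (max 2 (16 / am)) * Real.sqrt (27 + 2025 / 8 * am)) / 2) (2 / ((1 + 25 / 8) * (600 * (27 / 4) ^ 6 + am)) / (3 * (Real.sqrt (max 2 (16 / am)) * (2 + Real.sqrt (max 2 (16 / am))) * (3 * Real.sqrt 3 + 27 + 9 * Real.sqrt am * Real.sqrt (25 / 8) + 81 * am * (25 / 8)) * (8 * Real.sqrt (max 2 (16 / am)) + 8 * Real.sqrt (max 2 (16 /
          am)) ^ 2) * (10 * Real.sqrt (25 / 8)) + 9 * max 2 (16 / am) * Real.sqrt (25 / 8)))))) ^ 3) * ((14 * (8 * Real.exp (3 * min (1 / (10 * Real.sqrt (max 2 (16 / am)) * Real.sqrt (27 + 2025 / 8 * am))) (1 / 4)) * (5 / 2 + Real.exp (3 * (1 / (10 * Real.sqrt (max 2 (16 / am)) * Real.sqrt (27 + 2025 / 8 * am)))) * (am * (5 / 2) * (25 / 8) * (8 * max 2 (16 / am)))))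
          + Real.sqrt 432 * (Real.sqrt (8 * Real.exp (3 * min (1 / (10 * Real.sqrt (max 2 (16 / am)) * Real.sqrt (27 + 2025 / 8 * am))) (1 / 4)) * Real.exp (6 * (1 / (10 * Real.sqrt (max 2 (16 / am)) * Real.sqrt (27 + 2025 / 8 * am)))) * (2 * (1 + 1 / (1 / (10 * Real.sqrt (max 2 (16 / am)) * Real.sqrt (27 + 2025 / 8 * am))))) ^ 3) * (8 * max 2 (16 / am) * Real.sqrt
          (25 / 8)))) * (2 * (1 + 1 / (min (1 / (10 * Real.sqrt (max 2 (16 / am)) * Real.sqrt (27 + 2025 / 8 * am))) (1 / 4) / 2))) ^ 3) * (2 * (8 * Ch * (1 + am * (5 / 4 * Real.sqrt 2) * Real.sqrt (25 / 8)) + 1) ^ 3 * Real.sqrt (3 * Real.exp (12 * (1 / (10 * Real.sqrt (max 2 (16 / am)) * Real.sqrt (27 + 2025 / 8 * am)))) * (2 * (1 + 1 / (2 * (1 / (10 * Real.sqrt (max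
          2 (16 / am)) * Real.sqrt (27 + 2025 / 8 * am)))))) ^ 3 * (32 * max 2 (16 / am) + 384 * Real.exp 1 ^ 2 * (1 / (10 * Real.sqrt (max 2 (16 / am)) * Real.sqrt (27 + 2025 / 8 * am))) ^ 2 * max 2 (16 / am) ^ 2)) + 1)) + 2 * Real.sqrt 2 * (48 * ε₀) * ((14 * (8 * Real.exp (3 * min (1 / (10 * Real.sqrt (max 2 (16 / am)) * Real.sqrt (27 + 2025 / 8 * am))) (1 / 4)) *
          (1 + Real.exp (3 * (1 / (10 * Real.sqrt (max 2 (16 / am)) * Real.sqrt (27 + 2025 / 8 * am)))) * (am * (5 / 4 * Real.sqrt 2) * Real.sqrt (25 / 8) * (8 * Real.sqrt (max 2 (16 / am)) ^ 2)))) + Real.sqrt 216 * (Real.sqrt (8 * Real.exp (3 * min (1 / (10 * Real.sqrt (max 2 (16 / am)) * Real.sqrt (27 + 2025 / 8 * am))) (1 / 4)) * Real.exp (6 * (1 / (10 * Real.sqrt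
          (max 2 (16 / am)) * Real.sqrt (27 + 2025 / 8 * am)))) * (2 * (1 + 1 / (1 / (10 * Real.sqrt (max 2 (16 / am)) * Real.sqrt (27 + 2025 / 8 * am))))) ^ 3) * (8 * Real.sqrt (max 2 (16 / am)) ^ 2))) * (2 * (1 + 1 / (min (1 / (10 * Real.sqrt (max 2 (16 / am)) * Real.sqrt (27 + 2025 / 8 * am))) (1 / 4) / 2))) ^ 3 * (10 * (18 / (2 / ((1 + 25 / 8) * (600 * (27 / 4) ^
          6 + am))) ^ 2) * (4 * (2 * (1 + 1 / min (1 / (10 * Real.sqrt (max 2 (16 / am)) * Real.sqrt (27 + 2025 / 8 * am)) / 2) (2 / ((1 + 25 / 8) * (600 * (27 / 4) ^ 6 + am)) / (3 * (Real.sqrt (max 2 (16 / am)) * (2 + Real.sqrt (max 2 (16 / am))) * (3 * Real.sqrt 3 + 27 + 9 * Real.sqrt am * Real.sqrt (25 / 8) + 81 * am * (25 / 8)) * (8 * Real.sqrt (max 2 (16 / am)) +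
          8 * Real.sqrt (max 2 (16 / am)) ^ 2) * (10 * Real.sqrt (25 / 8)) + 9 * max 2 (16 / am) * Real.sqrt (25 / 8)))))) ^ 3) * ((14 * (8 * Real.exp (3 * min (1 / (10 * Real.sqrt (max 2 (16 / am)) * Real.sqrt (27 + 2025 / 8 * am))) (1 / 4)) * (5 / 2 + Real.exp (3 * (1 / (10 * Real.sqrt (max 2 (16 / am)) * Real.sqrt (27 + 2025 / 8 * am)))) * (am * (5 / 2) * (25 / 8)
          * (8 * max 2 (16 / am))))) + Real.sqrt 432 * (Real.sqrt (8 * Real.exp (3 * min (1 / (10 * Real.sqrt (max 2 (16 / am)) * Real.sqrt (27 + 2025 / 8 * am))) (1 / 4)) * Real.exp (6 * (1 / (10 * Real.sqrt (max 2 (16 / am)) * Real.sqrt (27 + 2025 / 8 * am)))) * (2 * (1 + 1 / (1 / (10 * Real.sqrt (max 2 (16 / am)) * Real.sqrt (27 + 2025 / 8 * am))))) ^ 3) * (8 * max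
          2 (16 / am) * Real.sqrt (25 / 8)))) * (2 * (1 + 1 / (min (1 / (10 * Real.sqrt (max 2 (16 / am)) * Real.sqrt (27 + 2025 / 8 * am))) (1 / 4) / 2))) ^ 3) * (2 * (8 * Ch * (1 + am * (5 / 4 * Real.sqrt 2) * Real.sqrt (25 / 8)) + 1) ^ 3 * Real.sqrt (3 * Real.exp (12 * (1 / (10 * Real.sqrt (max 2 (16 / am)) * Real.sqrt (27 + 2025 / 8 * am)))) * (2 * (1 + 1 / (2 *
          (1 / (10 * Real.sqrt (max 2 (16 / am)) * Real.sqrt (27 + 2025 / 8 * am)))))) ^ 3 * (32 * max 2 (16 / am) + 384 * Real.exp 1 ^ 2 * (1 / (10 * Real.sqrt (max 2 (16 / am)) * Real.sqrt (27 + 2025 / 8 * am))) ^ 2 * max 2 (16 / am) ^ 2)) + 1))))))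
          * ‖A‖ * (tdist (periodsT3 (F.cover 3) K) yt yt' / ((F.L : ℝ) ^ (K - n))) ^ ((1 : ℝ) / 2) := by
  have hc₀ : 0 < c₀ := Fact.out
  have hc₁ : 0 < c₀ * ((F.L : ℝ) ^ 3) ^ (K - n) := hc₁.out
  have hL1 : (1 : ℝ) < F.L := by exact_mod_cast F.hL.2
  have hL0 : (0 : ℝ) < F.L := by linarith
  have hLP := (F.P K).L_pos
  -- `ε₀ ≤ 1` and `ε₀ ≤ θ₀∕48`
  have hε1 : ε₀ ≤ 1 := by
    have h3 : (1 : ℝ) ≤ (F.L : ℝ) ^ 3 := one_le_pow₀ hL1.le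
    nlinarith [hε₀]
  have hεθ : ε₀ ≤ θ₀ / 48 := by linarith
  -- the pin's raw letters
  have hsx : (25 / 8) * (c₀ * ((F.L : ℝ) ^ 3) ^ (K - n) * ((((F.P K).L : ℝ) ^ (F.P K).d) ^ (K - n))⁻¹ / c₀) = 25 / 8 := by
    rw [show ((F.P K).L : ℝ) = (F.L : ℝ) from rfl, T3Family.P_d]; field_simp
  have hMraw : 16 * c₀ * ((F.L : ℝ) ^ (K - n)) ^ 3 / (am * (c₀ * ((F.L : ℝ) ^ 3) ^ (K - n))) = 16 / am := by
    rw [← pow_mul, ← pow_mul, Nat.mul_comm]; field_simp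
  have hM : max 2 (16 * c₀ * ((F.L : ℝ) ^ (K - n)) ^ 3 / (am * (c₀ * ((F.L : ℝ) ^ 3) ^ (K - n)))) = max 2 (16 / am) := by rw [hMraw]
  have hη : 0 < eta F n K := eta_pos F n K
  have hη1 : eta F n K ≤ 1 := by
    show ((F.L : ℝ)⁻¹) ^ (K - n) ≤ 1
    exact pow_le_one₀ (inv_nonneg.2 hL0.le) (inv_le_one_of_one_le₀ hL1.le)
  -- the window at slope `μ(am)`
  have hM'2 : (2 : ℝ) ≤ max 2 (16 / am) := le_max_left _ _
  have hcδ1 : (1 : ℝ) ≤ 27 + 2025 / 8 * am := by linarith [ham.le]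
  have hsM1 : 1 ≤ Real.sqrt (max 2 (16 / am)) := Real.one_le_sqrt.2 (by linarith)
  have hsc1 : 1 ≤ Real.sqrt (27 + 2025 / 8 * am) := Real.one_le_sqrt.2 hcδ1
  have hμ0 : 0 < (1 / (10 * Real.sqrt (max 2 (16 / am)) * Real.sqrt (27 + 2025 / 8 * am))) := by positivity
  have hμ10 : 10 * (1 / (10 * Real.sqrt (max 2 (16 / am)) * Real.sqrt (27 + 2025 / 8 * am))) ≤ 1 := by
    have h1 : (1 : ℝ) ≤ Real.sqrt (max 2 (16 / am)) * Real.sqrt (27 + 2025 / 8 * am) := one_le_mul_of_one_le_of_one_le hsM1 hsc1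
    rw [show 10 * (1 / (10 * Real.sqrt (max 2 (16 / am)) * Real.sqrt (27 + 2025 / 8 * am))) = 1 / (Real.sqrt (max 2 (16 / am)) * Real.sqrt (27 + 2025 / 8 * am)) by field_simp]
    rw [div_le_one (by positivity)]
    exact h1
  have hμ3 : 3 * (1 / (10 * Real.sqrt (max 2 (16 / am)) * Real.sqrt (27 + 2025 / 8 * am))) ≤ 1 := by linarith
  have hμ1 : (1 / (10 * Real.sqrt (max 2 (16 / am)) * Real.sqrt (27 + 2025 / 8 * am))) ≤ 1 := by linarith
  have hδ := window_delta (a := am) (sx := ((25 / 8) * (c₀ * ((F.L : ℝ) ^ 3) ^ (K - n) * ((((F.P K).L : ℝ) ^ (F.P K).d) ^ (K - n))⁻¹ / c₀))) (η := eta F n K) ham hsx hη hη1 hμ0.le hμ3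
  have hδe := window_delta_exp (a := am) (sx := ((25 / 8) * (c₀ * ((F.L : ℝ) ^ 3) ^ (K - n) * ((((F.P K).L : ℝ) ^ (F.P K).d) ^ (K - n))⁻¹ / c₀))) ham hsx hμ0.le hμ3
  have hwin := window_win ham hM
  have hδ₁ : 0 ≤ Real.sqrt (27 + 2025 / 8 * am) * (1 / (10 * Real.sqrt (max 2 (16 / am)) * Real.sqrt (27 + 2025 / 8 * am))) := by positivity
  -- V5b's column letter and the (L3′b) sign data
  have hcol := hcol_of_massiveColumn_decay F h hε₀ hε7 U₀ hreg Q'' hseq ι hι T hT ham G hAG hμ0 (δ₂ := Real.sqrt (27 + 2025 / 8 * am) * (1 / (10 * Real.sqrt (max 2 (16 / am)) * Real.sqrt (27 + 2025 / 8 * am)))) (by positivity) hδ hwin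
  have hκ : 0 < min (1 / (10 * Real.sqrt (max 2 (16 / am)) * Real.sqrt (27 + 2025 / 8 * am))) (1 / 4) / 2 := by positivity
  have hCpt : 0 ≤ (14 * (8 * Real.exp (3 * min (1 / (10 * Real.sqrt (max 2 (16 / am)) * Real.sqrt (27 + 2025 / 8 * am))) (1 / 4)) * ((5 / 4) * Real.sqrt (2 * (c₀ * ((F.L : ℝ) ^ 3) ^ (K - n))) * ((((F.P K).L : ℝ) ^ (F.P K).d) ^ (K - n))⁻¹ / c₀ * Real.sqrt (2 * (c₀ * ((F.L : ℝ) ^ 3) ^ (K - n))) + Real.exp (3 * (1 / (10 * Real.sqrt (max 2 (16 / am)) * Real.sqrt (27 + 2025 / 8 * am)))) * ((am * ((5 / 4) * Real.sqrt (2 * (c₀ * ((F.L : ℝ) ^ 3) ^ (K - n))) * ((((F.P K).L : ℝ) ^ (F.P K).d) ^ (K - n))⁻¹ / c₀) * Real.sqrt ((25 / 8) * ((c₀ * ((F.L : ℝ) ^ 3) ^ (K - n)) * ((((F.P K).L : ℝ) ^ (F.P K).d) ^ (K - n))⁻¹ / c₀))) * ((8 * Real.sqrt (max 2 (16 * c₀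 * ((F.L : ℝ) ^ (K - n)) ^ 3 / (am * (c₀ * ((F.L : ℝ) ^ 3) ^ (K - n))))) ^ 2) * (Real.sqrt ((25 / 8) * ((c₀ * ((F.L : ℝ) ^ 3) ^ (K - n)) * ((((F.P K).L : ℝ) ^ (F.P K).d) ^ (K - n))⁻¹ / c₀)) * Real.sqrt (2 * (c₀ * ((F.L : ℝ) ^ 3) ^ (K - n))))))))) + (Real.sqrt (3 ^ 3 / (c₀ * ((F.L : ℝ) ^ (K - n)) ^ 3) * 8) * (Real.sqrt (8 * Real.exp (3 * min (1 / (10 * Real.sqrt (max 2 (16 / am)) * Real.sqrt (27 + 2025 / 8 * am))) (1 / 4)) * Real.exp (6 * (1 / (10 * Real.sqrt (max 2 (16 / am)) * Real.sqrt (27 + 2025 / 8 * am)))) * (2 * (1 + 1 / (1 / (10 * Real.sqrt (max 2 (16 / am)) * Real.sqrt (27 + 2025 / 8 * am))))) ^ 3) * ((8 * Real.sqrt (max 2 (16 * c₀ * ((F.L : ℝ) ^ (K - n)) ^ 3 / (am * (c₀ * ((F.L : ℝ) ^ 3) ^ (K - n))))) ^ 2) * (Real.sqrt ((25 / 8) *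 ((c₀ * ((F.L : ℝ) ^ 3) ^ (K - n)) * ((((F.P K).L : ℝ) ^ (F.P K).d) ^ (K - n))⁻¹ / c₀)) * Real.sqrt (2 * (c₀ * ((F.L : ℝ) ^ 3) ^ (K - n))))))) := by positivity
  -- the complementary-source letters at the pin (`Cc :=` n-level sites, `cs := c`, `Tc := T`)
  obtain ⟨c, hcompl', hsrc'⟩ := hsrc_pin_exists F h hε₀ hε7 U₀ hreg Q'' hseq hnK ham ι hι T hT G hAG hGA hκ hCpt hcol
  have hcompl : ∀ g : SiteL2K ℂ 3 (periodsT3 F K) c₀ W₂, g - RS F n K h c₀ cB U₀ g = G (T (c g)) := fun g => by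
    rw [hRS]; exact hcompl' g
  -- the `hUsup` knit (px5 g16) at the (β-L²) window, `hPen` (px13 g17), `hGw`∕`hDw` (px13 g17 adapters)
  have hUsup := sup_G_DstarL2_le F h hε₀ hε7 U₀ hreg Q'' hseq ι hι T hT ham G hAG Ch θ₀ hCh hHlocV hεθ hμ0 hμ1 hδ₁ hδe hwin
  have hPen := hPen_of_regPr F h hε₀ hε7 U₀ hreg Q'' hseq ι hι T hT ham
  have hGw := hGw_of_lift F h hε₀ hε7 U₀ hreg Q'' hseq ι hι T hT ham G hAG hμ0 hδ₁ hδ hwin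
  have hDw := hDw_of_lift F h hε₀ hε7 U₀ hreg Q'' hseq ι hι T hT ham G hAG hμ0 hδ₁ hδ hwin hsmall
  have hCg := exists_curved_localGradient.choose_spec.1
  have hCax := norm_bgOfCfg_axialT_sub_le.choose_spec.1
  have hm0 : 0 < max 2 (16 / am) := lt_of_lt_of_le two_pos hM'2
  have key := hax_omega_one F h U₀ Q'' hseq ι T hT G hAG hGA hRS hker hε₀ hε1 hreg ham.le hp hΔs hΔ hθ hHlocV hCw hθw hWsup (by positivity) hUsup
    (by positivity) hPen c T hcompl (by positivity) (fun g Vb _ hg => hsrc' g Vb hg) (by positivity) (by positivity) hGw hDw hsmall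
  rw [unitU3_pin F hc₀ ham, unitU1_pin F hc₀ ham, unitA_pin F hc₀, unitP1_pin F hc₀ ham, unitP2_pin F hc₀ ham, unitP3_pin F hc₀ ham, unitPen_pin F hc₀ am, hM] at key
  exact key

/-! ## §2 The same with the LOD data and the Lift identity of record discharged (Lift antecedent displayed) -/

section Member
include hε₀ hreg in
set_option maxHeartbeats 400000 in
/-- ★★★ **(M) AT ONE MEMBER, FAMILIES OF RECORD DISCHARGED** — §1 with `Q″ hseq hker ← exists_intertwiner_of_regPr`, `hRS ← RS_eq_projR_of_lift (hLift)`, `ι` by `rfl`, `T := (ι∘Q″)†`,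
`G ← exists_massive_inverse` (mass `am`); displayed: `RegPr F n K ε₀ U₀` with `10¹²L³ε₀ ≤ 1`, the face's Lift antecedent, the slot class, the two local letters with their caps, `hsmall`.
[cite: Balaban1985BackgroundPropagators, (3.20)–(3.25) p.394, Thm 3.1 (3.42)–(3.46) pp.397–398, (3.49) p.399; Balaban1985Variational, (138)–(139) p.299] -/
theorem hax_omega_one_member_of_lift (hnK : n < K) (hε12 : 10 ^ 12 * (F.L : ℝ) ^ 3 * ε₀ ≤ 1) {am : ℝ} (ham : 0 < am)
    (hLift : ∀ cf : Site (F.P K) (K - n) → Matrix (Fin 2) (Fin 2) ℂ,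
      (∀ e : PBond (F.P K) (K - n), cf e.src = ((emlIterU (K - n) (bgUnits F K U₀) e : (Matrix (Fin 2) (Fin 2) ℂ)ˣ) : Matrix (Fin 2) (Fin 2) ℂ) * cf e.tgt *
        (((emlIterU (K - n) (bgUnits F K U₀) e)⁻¹ : (Matrix (Fin 2) (Fin 2) ℂ)ˣ) : Matrix (Fin 2) (Fin 2) ℂ)) →
      ∃ l₀ : Site (F.P K) 0 → Matrix (Fin 2) (Fin 2) ℂ,
        (∀ b : PBond (F.P K) 0, l₀ b.src = ((bgUnits F K U₀ b : (Matrix (Fin 2) (Fin 2) ℂ)ˣ) : Matrix (Fin 2) (Fin 2) ℂ) * l₀ b.tgt * (((bgUnits F K U₀ b)⁻¹ : (Matrix (Fin 2) (Fin 2) ℂ)ˣ) : Matrix (Fin 2) (Fin 2) ℂ)) ∧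
        ∀ y : Site (F.P K) (K - n), l₀ (embIter (K - n) y) = cf y)
    {aT : ℝ} {Δx : GaugeField (F.P K) 0 (Matrix.specialUnitaryGroup (Fin 2) ℂ) → (BondL2K ℂ 3 (periodsT3 F K) c₀ W₂ →ₗ[ℂ] BondL2K ℂ 3 (periodsT3 F K) c₀ W₂)}
    (hp : PosOnto F n K h c₀ cB aT Δx U₀) (hΔs : (Δx U₀).IsSymmetric) (hΔ : ∀ l ∈ NS F n K h c₀ cB U₀, Δx U₀ (DL2 F n K c₀ U₀ l) = 0)
    {Ch θ₀ : ℝ} (hCh : 0 ≤ Ch) (hθ : 48 * ε₀ ≤ θ₀)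
    (hHlocV : ∀ (F : T3Family) (n K : ℕ) (c₀ : ℝ) [Fact (0 < c₀)] (V : GaugeField (F.P K) 0 (Matrix.specialUnitaryGroup (Fin 2) ℂ))
      (u q : SiteL2K ℂ 3 (periodsT3 F K) c₀ W₂) (f : BondL2K ℂ 3 (periodsT3 F K) c₀ W₂) (x : TSite 3 (periodsT3 F K)) (Mu Mf Mq δ : ℝ),
      0 ≤ Mu → 0 ≤ Mf → 0 ≤ Mq → 0 ≤ δ → (F.L : ℝ) ^ (K - n) * δ ≤ θ₀ →
      covLapSite F n K c₀ V u + q = DstarL2 F n K c₀ V f →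
      (∀ y, tdist (periodsT3 F K) x y ≤ 4 * (F.L : ℝ) ^ (K - n) + 1 → ‖WL2.equiv ℂ (fun _ : TSite 3 (periodsT3 F K) => c₀) W₂ u y‖ ≤ Mu) →
      (∀ (y : TSite 3 (periodsT3 F K)) (μ : Fin 3), tdist (periodsT3 F K) x y ≤ 4 * (F.L : ℝ) ^ (K - n) + 1 →
        ‖WL2.equiv ℂ (fun _ : Bond 3 (periodsT3 F K) => c₀) W₂ f (y, μ)‖ ≤ Mf) →
      (∀ y, tdist (periodsT3 F K) x y ≤ 4 * (F.L : ℝ) ^ (K - n) + 1 → ‖WL2.equiv ℂ (fun _ : TSite 3 (periodsT3 F K) => c₀) W₂ q y‖ ≤ Mq) →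
      (∀ (y : TSite 3 (periodsT3 F K)) (μ : Fin 3), tdist (periodsT3 F K) x y ≤ 4 * (F.L : ℝ) ^ (K - n) + 1 →
        ‖((bgOfCfg F K V (y, μ) : (Matrix (Fin 2) (Fin 2) ℂ)ˣ) : Matrix (Fin 2) (Fin 2) ℂ) - 1‖ ≤ δ) →
      ∀ x' : TSite 3 (periodsT3 F K), tdist (periodsT3 F K) x x' ≤ (F.L : ℝ) ^ (K - n) →
        ‖WL2.equiv ℂ (fun _ : TSite 3 (periodsT3 F K) => c₀) W₂ u x' - WL2.equiv ℂ (fun _ : TSite 3 (periodsT3 F K) => c₀) W₂ u x‖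
          ≤ Ch * (Mu + Mf + Mq) * (tdist (periodsT3 F K) x x' / ((F.L : ℝ) ^ (K - n))) ^ ((1 : ℝ) / 2))
    {Cw θw : ℝ} (hCw : 0 ≤ Cw) (hθw : ε₀ ≤ θw)
    (hWsup : ∀ (F : T3Family) (n K : ℕ) (c₀ : ℝ) [Fact (0 < c₀)] (ε₀ : ℝ) (U₀ : GaugeField (F.P K) 0 (Matrix.specialUnitaryGroup (Fin 2) ℂ)),
      0 ≤ ε₀ → ε₀ ≤ θw → RegPr F n K ε₀ U₀ →
      ∀ (w : SiteL2K ℂ 3 (periodsT3 F K) c₀ W₂) (x : BondL2K ℂ 3 (periodsT3 F K) c₀ W₂) (X : ℝ), 0 ≤ X →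
      covLapSite F n K c₀ U₀ w + ((1 : ℝ) : ℂ) • w = DstarL2 F n K c₀ U₀ x →
      (∀ b : Bond 3 (periodsT3 F K), ‖WL2.equiv ℂ (fun _ : Bond 3 (periodsT3 F K) => c₀) W₂ x b‖ ≤ X) →
      ∀ y : TSite 3 (periodsT3 F K), ‖WL2.equiv ℂ (fun _ : TSite 3 (periodsT3 F K) => c₀) W₂ w y‖ ≤ Cw * X)
    (hsmall : exists_curved_localGradient.choose * ((48 * ε₀) * (6 * Real.sqrt 2 * Real.sqrt 10 + 6 * Real.sqrt 2)) ≤ 1 / 2) :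
    ∀ A : PBond (F.P K) 0 → Matrix (Fin 2) (Fin 2) ℂ,
    ∀ (ct : Site ((F.cover 3).P K) 0) (yt yt' : TSite 3 (periodsT3 (F.cover 3) K)),
      tdist (periodsT3 (F.cover 3) K) (siteEquiv (F.cover 3) K ct) yt ≤ 4 * (F.L : ℝ) ^ (K - n) + 1 →
      tdist (periodsT3 (F.cover 3) K) (siteEquiv (F.cover 3) K ct) yt' ≤ 4 * (F.L : ℝ) ^ (K - n) + 1 →
      tdist (periodsT3 (F.cover 3) K) yt yt' ≤ (F.L : ℝ) ^ (K - n) →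
      ‖WL2.equiv ℂ (fun _ : TSite 3 (periodsT3 (F.cover 3) K) => c₀) W₂
            (toL2S (F.cover 3) K c₀ (fun zt => ((axialT (U₀ ∘ projBond (F.P K) 3 0) ct zt : Matrix.specialUnitaryGroup (Fin 2) ℂ) : Matrix (Fin 2) (Fin 2) ℂ)
              * (toL2S F K c₀).symm (RS F n K h c₀ cB U₀ (DstarL2 F n K c₀ U₀ (GT F n K h c₀ cB aT Δx U₀ (toL2 F K c₀ A)))) (proj (F.P K) 3 0 zt)
              * star ((axialT (U₀ ∘ projBond (F.P K) 3 0) ct zt : Matrix.specialUnitaryGroup (Fin 2) ℂ) : Matrix (Fin 2) (Fin 2) ℂ))) yt'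
          - WL2.equiv ℂ (fun _ : TSite 3 (periodsT3 (F.cover 3) K) => c₀) W₂
            (toL2S (F.cover 3) K c₀ (fun zt => ((axialT (U₀ ∘ projBond (F.P K) 3 0) ct zt : Matrix.specialUnitaryGroup (Fin 2) ℂ) : Matrix (Fin 2) (Fin 2) ℂ)
              * (toL2S F K c₀).symm (RS F n K h c₀ cB U₀ (DstarL2 F n K c₀ U₀ (GT F n K h c₀ cB aT Δx U₀ (toL2 F K c₀ A)))) (proj (F.P K) 3 0 zt)
              * star ((axialT (U₀ ∘ projBond (F.P K) 3 0) ct zt : Matrix.specialUnitaryGroup (Fin 2) ℂ) : Matrix (Fin 2) (Fin 2) ℂ))) yt‖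
        ≤ (Real.sqrt 2 * (Ch * (2 * Cw + 1) + 3 * Real.sqrt 10 * (2 * (exists_curved_localGradient.choose * ((2 * (8 * Ch * (1 + am * (5 / 4 * Real.sqrt 2) * Real.sqrt (25 / 8)) + 1) ^ 3 * Real.sqrt (3 * Real.exp (12 * (1 / (10 * Real.sqrt (max 2 (16 / am)) * Real.sqrt (27 + 2025 / 8 * am)))) * (2 * (1 + 1 / (2 * (1 / (10 * Real.sqrt (max 2 (16 / am)) * Real.sqrt (27 +
          2025 / 8 * am)))))) ^ 3 * (32 * max 2 (16 / am) + 384 * Real.exp 1 ^ 2 * (1 / (10 * Real.sqrt (max 2 (16 / am)) * Real.sqrt (27 + 2025 / 8 * am))) ^ 2 * max 2 (16 / am) ^ 2)) + 1 + Cw) * (2 + 2 * Real.sqrt 2 * (4 * ε₀ * (3 + 2457 * norm_bgOfCfg_axialT_sub_le.choose)) + (24 * Real.sqrt 10 + 48) * (48 * ε₀) ^ 2) + (am * (5 / 4 * Real.sqrt 2) * Real.sqrt (25 /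
          8) * (2 * (8 * Ch * (1 + am * (5 / 4 * Real.sqrt 2) * Real.sqrt (25 / 8)) + 1) ^ 3 * Real.sqrt (3 * Real.exp (12 * (1 / (10 * Real.sqrt (max 2 (16 / am)) * Real.sqrt (27 + 2025 / 8 * am)))) * (2 * (1 + 1 / (2 * (1 / (10 * Real.sqrt (max 2 (16 / am)) * Real.sqrt (27 + 2025 / 8 * am)))))) ^ 3 * (32 * max 2 (16 / am) + 384 * Real.exp 1 ^ 2 * (1 / (10 *
          Real.sqrt (max 2 (16 / am)) * Real.sqrt (27 + 2025 / 8 * am))) ^ 2 * max 2 (16 / am) ^ 2)) + 1) + Cw)) + 2 * Real.sqrt 2 * (48 * ε₀) * (2 * (8 * Ch * (1 + am * (5 / 4 * Real.sqrt 2) * Real.sqrt (25 / 8)) + 1) ^ 3 * Real.sqrt (3 * Real.exp (12 * (1 / (10 * Real.sqrt (max 2 (16 / am)) * Real.sqrt (27 + 2025 / 8 * am)))) * (2 * (1 + 1 / (2 * (1 / (10 *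
          Real.sqrt (max 2 (16 / am)) * Real.sqrt (27 + 2025 / 8 * am)))))) ^ 3 * (32 * max 2 (16 / am) + 384 * Real.exp 1 ^ 2 * (1 / (10 * Real.sqrt (max 2 (16 / am)) * Real.sqrt (27 + 2025 / 8 * am))) ^ 2 * max 2 (16 / am) ^ 2)) + 1 + Cw)) + 2 * Real.sqrt 2 * (48 * ε₀) * (2 * (8 * Ch * (1 + am * (5 / 4 * Real.sqrt 2) * Real.sqrt (25 / 8)) + 1) ^ 3 * Real.sqrt (3 *
          Real.exp (12 * (1 / (10 * Real.sqrt (max 2 (16 / am)) * Real.sqrt (27 + 2025 / 8 * am)))) * (2 * (1 + 1 / (2 * (1 / (10 * Real.sqrt (max 2 (16 / am)) * Real.sqrt (27 + 2025 / 8 * am)))))) ^ 3 * (32 * max 2 (16 / am) + 384 * Real.exp 1 ^ 2 * (1 / (10 * Real.sqrt (max 2 (16 / am)) * Real.sqrt (27 + 2025 / 8 * am))) ^ 2 * max 2 (16 / am) ^ 2)) + 1 + Cw)) + 3 *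
          Real.sqrt 10 * (2 * (exists_curved_localGradient.choose * ((14 * (8 * Real.exp (3 * min (1 / (10 * Real.sqrt (max 2 (16 / am)) * Real.sqrt (27 + 2025 / 8 * am))) (1 / 4)) * (1 + Real.exp (3 * (1 / (10 * Real.sqrt (max 2 (16 / am)) * Real.sqrt (27 + 2025 / 8 * am)))) * (am * (5 / 4 * Real.sqrt 2) * Real.sqrt (25 / 8) * (8 * Real.sqrt (max 2 (16 / am)) ^ 2))))
          + Real.sqrt 216 * (Real.sqrt (8 * Real.exp (3 * min (1 / (10 * Real.sqrt (max 2 (16 / am)) * Real.sqrt (27 + 2025 / 8 * am))) (1 / 4)) * Real.exp (6 * (1 / (10 * Real.sqrt (max 2 (16 / am)) * Real.sqrt (27 + 2025 / 8 * am)))) * (2 * (1 + 1 / (1 / (10 * Real.sqrt (max 2 (16 / am)) * Real.sqrt (27 + 2025 / 8 * am))))) ^ 3) * (8 * Real.sqrt (max 2 (16 / am)) ^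
          2))) * (2 * (1 + 1 / (min (1 / (10 * Real.sqrt (max 2 (16 / am)) * Real.sqrt (27 + 2025 / 8 * am))) (1 / 4) / 2))) ^ 3 * (2 + 2 * Real.sqrt 2 * (4 * ε₀ * (3 + 2457 * norm_bgOfCfg_axialT_sub_le.choose)) + (24 * Real.sqrt 10 + 48) * (48 * ε₀) ^ 2) + (am * (5 / 4 * Real.sqrt 2) * Real.sqrt (25 / 8) * (Real.exp (3 * (1 / (10 * Real.sqrt (max 2 (16 / am)) *
          Real.sqrt (27 + 2025 / 8 * am)))) * (8 * Real.sqrt (max 2 (16 / am)) ^ 2)) * (2 * (1 + 1 / (1 / (10 * Real.sqrt (max 2 (16 / am)) * Real.sqrt (27 + 2025 / 8 * am))))) ^ 3 + 1)) + 2 * Real.sqrt 2 * (48 * ε₀) * ((14 * (8 * Real.exp (3 * min (1 / (10 * Real.sqrt (max 2 (16 / am)) * Real.sqrt (27 + 2025 / 8 * am))) (1 / 4)) * (1 + Real.exp (3 * (1 / (10 *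
          Real.sqrt (max 2 (16 / am)) * Real.sqrt (27 + 2025 / 8 * am)))) * (am * (5 / 4 * Real.sqrt 2) * Real.sqrt (25 / 8) * (8 * Real.sqrt (max 2 (16 / am)) ^ 2)))) + Real.sqrt 216 * (Real.sqrt (8 * Real.exp (3 * min (1 / (10 * Real.sqrt (max 2 (16 / am)) * Real.sqrt (27 + 2025 / 8 * am))) (1 / 4)) * Real.exp (6 * (1 / (10 * Real.sqrt (max 2 (16 / am)) * Real.sqrt
          (27 + 2025 / 8 * am)))) * (2 * (1 + 1 / (1 / (10 * Real.sqrt (max 2 (16 / am)) * Real.sqrt (27 + 2025 / 8 * am))))) ^ 3) * (8 * Real.sqrt (max 2 (16 / am)) ^ 2))) * (2 * (1 + 1 / (min (1 / (10 * Real.sqrt (max 2 (16 / am)) * Real.sqrt (27 + 2025 / 8 * am))) (1 / 4) / 2))) ^ 3)) * (10 * (18 / (2 / ((1 + 25 / 8) * (600 * (27 / 4) ^ 6 + am))) ^ 2) * (4 * (2 *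
          (1 + 1 / min (1 / (10 * Real.sqrt (max 2 (16 / am)) * Real.sqrt (27 + 2025 / 8 * am)) / 2) (2 / ((1 + 25 / 8) * (600 * (27 / 4) ^ 6 + am)) / (3 * (Real.sqrt (max 2 (16 / am)) * (2 + Real.sqrt (max 2 (16 / am))) * (3 * Real.sqrt 3 + 27 + 9 * Real.sqrt am * Real.sqrt (25 / 8) + 81 * am * (25 / 8)) * (8 * Real.sqrt (max 2 (16 / am)) + 8 * Real.sqrt (max 2 (16 /
          am)) ^ 2) * (10 * Real.sqrt (25 / 8)) + 9 * max 2 (16 / am) * Real.sqrt (25 / 8)))))) ^ 3) * ((14 * (8 * Real.exp (3 * min (1 / (10 * Real.sqrt (max 2 (16 / am)) * Real.sqrt (27 + 2025 / 8 * am))) (1 / 4)) * (5 / 2 + Real.exp (3 * (1 / (10 * Real.sqrt (max 2 (16 / am)) * Real.sqrt (27 + 2025 / 8 * am)))) * (am * (5 / 2) * (25 / 8) * (8 * max 2 (16 / am)))))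
          + Real.sqrt 432 * (Real.sqrt (8 * Real.exp (3 * min (1 / (10 * Real.sqrt (max 2 (16 / am)) * Real.sqrt (27 + 2025 / 8 * am))) (1 / 4)) * Real.exp (6 * (1 / (10 * Real.sqrt (max 2 (16 / am)) * Real.sqrt (27 + 2025 / 8 * am)))) * (2 * (1 + 1 / (1 / (10 * Real.sqrt (max 2 (16 / am)) * Real.sqrt (27 + 2025 / 8 * am))))) ^ 3) * (8 * max 2 (16 / am) * Real.sqrt
          (25 / 8)))) * (2 * (1 + 1 / (min (1 / (10 * Real.sqrt (max 2 (16 / am)) * Real.sqrt (27 + 2025 / 8 * am))) (1 / 4) / 2))) ^ 3) * (2 * (8 * Ch * (1 + am * (5 / 4 * Real.sqrt 2) * Real.sqrt (25 / 8)) + 1) ^ 3 * Real.sqrt (3 * Real.exp (12 * (1 / (10 * Real.sqrt (max 2 (16 / am)) * Real.sqrt (27 + 2025 / 8 * am)))) * (2 * (1 + 1 / (2 * (1 / (10 * Real.sqrt (max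
          2 (16 / am)) * Real.sqrt (27 + 2025 / 8 * am)))))) ^ 3 * (32 * max 2 (16 / am) + 384 * Real.exp 1 ^ 2 * (1 / (10 * Real.sqrt (max 2 (16 / am)) * Real.sqrt (27 + 2025 / 8 * am))) ^ 2 * max 2 (16 / am) ^ 2)) + 1)) + 2 * Real.sqrt 2 * (48 * ε₀) * ((14 * (8 * Real.exp (3 * min (1 / (10 * Real.sqrt (max 2 (16 / am)) * Real.sqrt (27 + 2025 / 8 * am))) (1 / 4)) *
          (1 + Real.exp (3 * (1 / (10 * Real.sqrt (max 2 (16 / am)) * Real.sqrt (27 + 2025 / 8 * am)))) * (am * (5 / 4 * Real.sqrt 2) * Real.sqrt (25 / 8) * (8 * Real.sqrt (max 2 (16 / am)) ^ 2)))) + Real.sqrt 216 * (Real.sqrt (8 * Real.exp (3 * min (1 / (10 * Real.sqrt (max 2 (16 / am)) * Real.sqrt (27 + 2025 / 8 * am))) (1 / 4)) * Real.exp (6 * (1 / (10 * Real.sqrt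
          (max 2 (16 / am)) * Real.sqrt (27 + 2025 / 8 * am)))) * (2 * (1 + 1 / (1 / (10 * Real.sqrt (max 2 (16 / am)) * Real.sqrt (27 + 2025 / 8 * am))))) ^ 3) * (8 * Real.sqrt (max 2 (16 / am)) ^ 2))) * (2 * (1 + 1 / (min (1 / (10 * Real.sqrt (max 2 (16 / am)) * Real.sqrt (27 + 2025 / 8 * am))) (1 / 4) / 2))) ^ 3 * (10 * (18 / (2 / ((1 + 25 / 8) * (600 * (27 / 4) ^
          6 + am))) ^ 2) * (4 * (2 * (1 + 1 / min (1 / (10 * Real.sqrt (max 2 (16 / am)) * Real.sqrt (27 + 2025 / 8 * am)) / 2) (2 / ((1 + 25 / 8) * (600 * (27 / 4) ^ 6 + am)) / (3 * (Real.sqrt (max 2 (16 / am)) * (2 + Real.sqrt (max 2 (16 / am))) * (3 * Real.sqrt 3 + 27 + 9 * Real.sqrt am * Real.sqrt (25 / 8) + 81 * am * (25 / 8)) * (8 * Real.sqrt (max 2 (16 / am)) +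
          8 * Real.sqrt (max 2 (16 / am)) ^ 2) * (10 * Real.sqrt (25 / 8)) + 9 * max 2 (16 / am) * Real.sqrt (25 / 8)))))) ^ 3) * ((14 * (8 * Real.exp (3 * min (1 / (10 * Real.sqrt (max 2 (16 / am)) * Real.sqrt (27 + 2025 / 8 * am))) (1 / 4)) * (5 / 2 + Real.exp (3 * (1 / (10 * Real.sqrt (max 2 (16 / am)) * Real.sqrt (27 + 2025 / 8 * am)))) * (am * (5 / 2) * (25 / 8)
          * (8 * max 2 (16 / am))))) + Real.sqrt 432 * (Real.sqrt (8 * Real.exp (3 * min (1 / (10 * Real.sqrt (max 2 (16 / am)) * Real.sqrt (27 + 2025 / 8 * am))) (1 / 4)) * Real.exp (6 * (1 / (10 * Real.sqrt (max 2 (16 / am)) * Real.sqrt (27 + 2025 / 8 * am)))) * (2 * (1 + 1 / (1 / (10 * Real.sqrt (max 2 (16 / am)) * Real.sqrt (27 + 2025 / 8 * am))))) ^ 3) * (8 * max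
          2 (16 / am) * Real.sqrt (25 / 8)))) * (2 * (1 + 1 / (min (1 / (10 * Real.sqrt (max 2 (16 / am)) * Real.sqrt (27 + 2025 / 8 * am))) (1 / 4) / 2))) ^ 3) * (2 * (8 * Ch * (1 + am * (5 / 4 * Real.sqrt 2) * Real.sqrt (25 / 8)) + 1) ^ 3 * Real.sqrt (3 * Real.exp (12 * (1 / (10 * Real.sqrt (max 2 (16 / am)) * Real.sqrt (27 + 2025 / 8 * am)))) * (2 * (1 + 1 / (2 *
          (1 / (10 * Real.sqrt (max 2 (16 / am)) * Real.sqrt (27 + 2025 / 8 * am)))))) ^ 3 * (32 * max 2 (16 / am) + 384 * Real.exp 1 ^ 2 * (1 / (10 * Real.sqrt (max 2 (16 / am)) * Real.sqrt (27 + 2025 / 8 * am))) ^ 2 * max 2 (16 / am) ^ 2)) + 1))))))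
          * ‖A‖ * (tdist (periodsT3 (F.cover 3) K) yt yt' / ((F.L : ℝ) ^ (K - n))) ^ ((1 : ℝ) / 2) := by
  have hc₀ : 0 < c₀ := Fact.out
  have hL : (0 : ℝ) < F.L := by have := F.hL.2; exact_mod_cast (by omega : 0 < F.L)
  have hε7 : 10 ^ 7 * (F.L : ℝ) ^ 3 * ε₀ ≤ 1 := by
    have h1 : (10 : ℝ) ^ 7 * (F.L : ℝ) ^ 3 * ε₀ ≤ 10 ^ 12 * (F.L : ℝ) ^ 3 * ε₀ := by
      have : 0 ≤ (F.L : ℝ) ^ 3 * ε₀ := by positivity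
      nlinarith
    exact h1.trans hε12
  -- the `Q″` of record, its ∃-form top-mean clause and `ker Q″ ≤ N_S`; the Lift identity `R_S = projR Δ Q″`
  obtain ⟨Q'', D', -, -, htop, hseq, hker⟩ := exists_intertwiner_of_regPr F h (c₀ := c₀) cB hε₀ hε12 U₀ hreg
  have hRS := RS_eq_projR_of_lift F h cB hε₀ hε12 U₀ hreg hLift Q'' htop hker
  -- the LOD data at the pinned weight: `ι` by `rfl`, `T := (ι∘Q″)†`, `G ← exists_massive_inverse`
  haveI : Fact (0 < c₀ * ((F.L : ℝ) ^ 3) ^ (K - n)) := ⟨by positivity⟩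
  obtain ⟨ι', hι'⟩ : ∃ ι' : (Site (F.P K) (K - n) → Matrix (Fin 2) (Fin 2) ℂ) →ₗ[ℂ] SiteL2K ℂ 3 (periodsT3 F n) (c₀ * ((F.L : ℝ) ^ 3) ^ (K - n)) W₂,
      ∀ c, ι' c = toL2S F n (c₀ * ((F.L : ℝ) ^ 3) ^ (K - n)) (fun z => c (siteShift (sites_eq F n K h) z)) :=
    ⟨(toL2S F n (c₀ * ((F.L : ℝ) ^ 3) ^ (K - n))).toLinearMap ∘ₗ LinearMap.funLeft ℂ (Matrix (Fin 2) (Fin 2) ℂ) (siteShift (sites_eq F n K h)), fun c => rfl⟩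
  obtain ⟨T', hT'⟩ : ∃ T' : SiteL2K ℂ 3 (periodsT3 F n) (c₀ * ((F.L : ℝ) ^ 3) ^ (K - n)) W₂ →ₗ[ℂ] SiteL2K ℂ 3 (periodsT3 F K) c₀ W₂,
      ∀ (l : SiteL2K ℂ 3 (periodsT3 F K) c₀ W₂) (f : SiteL2K ℂ 3 (periodsT3 F n) (c₀ * ((F.L : ℝ) ^ 3) ^ (K - n)) W₂), ⟪ι' (Q'' l), f⟫_ℂ = ⟪l, T' f⟫_ℂ :=
    ⟨LinearMap.adjoint (ι' ∘ₗ Q''), fun l f => by rw [LinearMap.adjoint_inner_right, LinearMap.comp_apply]⟩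
  obtain ⟨G', hAG', hGA', -⟩ := exists_massive_inverse F h hε₀ hε7 U₀ hreg Q'' hseq ι' hι' T' hT' ham
  exact hax_omega_one_member F h hε₀ hε7 U₀ hreg Q'' hseq hRS hker hnK ham ι' hι' T' hT' G' hAG' hGA' hp hΔs hΔ hCh hθ hHlocV hCw hθw hWsup hsmall

end Member

end Summit.QuantumFields.YangMills.Theorems.Prop7OmegaOneAxialHolderMember

end
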